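import Summits.Ventures.CertifiedArithmetic.LowPrec.GemmFirstRegimeLaw
import Summits.Ventures.CertifiedArithmetic.LowPrec.GemmFirstRegimeRowsMixed
import Summits.Ventures.CertifiedArithmetic.LowPrec.GemmFirstRegimeE2M1Law
import HarnessLib

/-!
# GEMM worst case LXIII-c — ROWS OF THE EXACT FIRST-REGIME LAW for the exceptional alphabets:
# E2M1² (`p ≡ 1, 2 (mod 6)`), E2M3·E2M1 and E3M2·E2M1 into binary32

HONEST FRAMING: certified error envelopes and provably optimal rounding/accumulation schemes for
low-precision formats under stated cost models; every table by two implementations; no hardware or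
vendor claims.

File LXIII-b (`relErr_le_firstRegimeLaw`) bounds EVERY word at `n₀ + 1 + d` letters by
`max((d+1)/(B+d+1), d/(T+d))` under the ENTRY-MASS hypothesis `H_B` (an odd partial sum of
`n₀ + 1 = j₀ + 2` letters beyond `T` in modulus has mass `≥ B + 1`) and the range condition (H1).
Here `H_B` is DISCHARGED, and the law made a two-sided EQUALITY, for the three alphabets whose
letters do not spell `T + 1`:

* THE DEFICIT AUTOMATON (`entryMass_of_automaton`, every grid alphabet): write `|zᵢ| = M - eᵢ`;
  the deficits of even letters satisfy a predicate `Pe`, those of odd letters `Po` (kernel `decide`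
  over the letter list); along the word these propagate to `EOK D` (partial sum still even) resp.
  `OOK D` (an odd letter was used) for the total deficit `D`; the mass is `M n - D`, and `OOK`
  excludes the masses `T+1, …, B`.
* E2M1², EVERY precision `p ≥ 13` (`worstP_firstRegimeLaw_one/_two`): even deficits are `0` or
  `≥ 48`, odd ones `135, 141, 143`; for `p ≡ 1 (mod 6)` (`144 j₀ + 128 = T`, `B = T + 16`)
  `W_φ(n₀+k) = max(k/(T+16+k), (k-1)/(T+k-1))`, for `p ≡ 2 (mod 6)` (`144 j₀ + 112 = T`,
  `B = T + 32`) `W_φ(n₀+k) = max(k/(T+32+k), (k-1)/(T+k-1))`, both for `1 ≤ k ≤ 2^(p-1) - 2^8`.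
* E2M3·E2M1 INTO binary32 (`worst4P_Binary32_law`): even deficits are multiples of `48` up to
  `240` or `≥ 272`, odd ones are `≥ 675`, odd, and `≡ 3 (mod 6)` or `≥ 35 (mod 48)`; hence
  `A* = 2^24 + 5` and `W_24(23302+k) = max(k/(2^24+4+k), (k-1)/(2^24+k-1))`, `1 ≤ k ≤ 2^23 - 2^11`.
* E3M2·E2M1 INTO binary32 (`worst5P_Binary32_law`): even deficits `0, 768` or `≥ 1536`, odd ones
  in `[5355, 5375]`; `A* = 2^24 + 513` and `W_24(3121+k) = max(k/(2^24+512+k), (k-1)/(2^24+k-1))`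
  for `1 ≤ k ≤ 2^23 - 2^13`.

The top slivers `2^(p-1) - 2^8 < k ≤ 2^(p-1)` (resp. `2^11`, `2^13`), where (H1) fails, keep the
bracket of files LXII-b/d. Second implementation: `code/gemm/firstregime/` (C2: `entry_p24.json`,
the `A*` values `2^24+5`, `2^24+513`; the E2M1² residues) and the DP tables of gemm.tex §Regimes.
References: [LangeRump2019], [BoldoEtAl2023, Thm 4.5], [Higham2002, §4.2],
[RouhaniEtAl2023MX, Table 1], [IEEE7542019, §4.3.1].
-/

namespace Summit.Ventures.CertifiedArithmetic.LowPrec.Gemm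

open Literature.ComputerArithmetic.FloatingPoint
open Literature.ComputerArithmetic.FloatingPoint.MiniFloat
open Literature.ComputerArithmetic.FloatingPoint.MiniFloat.ThetaLaw
open Finset

/-! ### The deficit automaton (every grid alphabet) -/

section Deficit

variable {G M m0 : ℕ} {x : ℕ → ℚ}
  (hx : ∀ j, ∃ z : ℤ, x j = (z : ℚ) / 2 ^ G ∧ z.natAbs ≤ M ∧ (z % 2 = 0 ∨ z.natAbs ≤ m0))
include hx

/-- THE DEFICIT AUTOMATON. Letters `|zᵢ| = M - eᵢ`; even letters have `Pe eᵢ`, odd ones `Po eᵢ`;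
`EOK` (from `EOK 0`, while the partial sum is even) and `OOK` (once an odd letter occurred) are
closed under adding deficits as stated. If `OOK D` together with a mass `M n - D > T` forces the
mass to be `≥ B + 1`, then every word whose `n`-th partial sum is odd and beyond `T` in modulus has
mass `≥ (B+1)/2^G` — the entry-mass hypothesis `H_B` of `relErr_le_firstRegimeLaw`.
[cell, gemm.tex Prop. p:fpL (iii)] -/
theorem entryMass_of_automaton {Pe Po EOK OOK : ℕ → Prop} (h0 : EOK 0)
    (hEE : ∀ D e, EOK D → Pe e → EOK (D + e)) (hEO : ∀ D e, EOK D → Po e → OOK (D + e))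
    (hO : ∀ D e, OOK D → (Pe e ∨ Po e) → OOK (D + e))
    (hlet : ∀ i, (zl G x i % 2 = 0 ∧ Pe (M - (zl G x i).natAbs)) ∨
      (zl G x i % 2 ≠ 0 ∧ Po (M - (zl G x i).natAbs)))
    {n T Bn : ℕ} (hwin : ∀ D L : ℕ, OOK D → L + D = M * n → T < L → Bn + 1 ≤ L) :
    (∑ i ∈ range n, zl G x i) % 2 ≠ 0 → T < (∑ i ∈ range n, zl G x i).natAbs →
      ((Bn : ℚ) + 1) / 2 ^ G ≤ ∑ i ∈ range n, |x i| := by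
  intro hodd hT
  have key : ∀ n, (∑ i ∈ range n, (zl G x i).natAbs) + (∑ i ∈ range n, (M - (zl G x i).natAbs))
      = M * n ∧ (OOK (∑ i ∈ range n, (M - (zl G x i).natAbs)) ∨
        ((∑ i ∈ range n, zl G x i) % 2 = 0 ∧ EOK (∑ i ∈ range n, (M - (zl G x i).natAbs)))) := by
    intro n
    induction n with
    | zero => exact ⟨by simp, Or.inr ⟨by simp, by simpa using h0⟩⟩
    | succ n ih =>
      obtain ⟨hm, hinv⟩ := ih
      have hzM := (zl_spec hx n).2.1
      simp only [sum_range_succ]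
      refine ⟨by rw [mul_add, mul_one, ← hm]; omega, ?_⟩
      rcases hlet n with ⟨hpe, hPe⟩ | ⟨hpo, hPo⟩
      · rcases hinv with hO' | ⟨hZ, hE⟩
        · exact Or.inl (hO _ _ hO' (Or.inl hPe))
        · exact Or.inr ⟨by omega, hEE _ _ hE hPe⟩
      · rcases hinv with hO' | ⟨hZ, hE⟩
        · exact Or.inl (hO _ _ hO' (Or.inr hPo))
        · exact Or.inl (hEO _ _ hE hPo)
  obtain ⟨hm, hinv⟩ := key n
  have hOK := hinv.resolve_right (fun h => hodd h.1)
  have hB := hwin _ _ hOK hm (lt_of_lt_of_le hT (Int.natAbs_sum_le _ _))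
  rw [sum_abs_eq_natG hx n]
  exact div_le_div_of_nonneg_right (by exact_mod_cast hB) (by positivity)

end Deficit

/-! ### The row engine: the upper half of the law for `W` = the attained maximum -/

section Rows

variable {G M m0 E : ℕ} {φ : Format} {L : ℚ → Prop} {W : ℕ → ℚ}
variable
  (hL : ∀ q, L q → ∃ z : ℤ, q = (z : ℚ) / 2 ^ G ∧ z.natAbs ≤ M ∧ (z % 2 = 0 ∨ z.natAbs ≤ m0))
  (hWge : ∀ m, ∃ x : ℕ → ℚ, (∀ j, L (x j)) ∧ W m = relErr φ x m)
  (hq : φ.qexp ≤ -(G : ℤ)) (hR : (2 : ℚ) ^ (φ.manBits + E + 3) ≤ φ.maxRat)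
  (hm0M : m0 ≤ M) (hMT : M ≤ 2 ^ (φ.manBits + 1)) (hm0 : 1 ≤ m0) (hME : M ≤ 2 ^ (G + E))
include hL hWge hq hR hm0M hMT hm0 hME

/-- THE LAW ROW, upper half: if every word of the alphabet satisfies `H_B` at `j₀ + 2` letters and
(H1) holds (`M(j₀+2) + Q = 2T`), then `W(j₀+1+d) ≤ max((d+1)/(B+d+1), d/(T+d))`.
[cell, gemm.tex Prop. p:fpL; cite: LangeRump2019; BoldoEtAl2023, Thm 4.5] -/
theorem gridW_le_firstRegimeLaw {j0 Bn Q d : ℕ} (hj0 : M * j0 + m0 < 2 ^ (φ.manBits + 1))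
    (hBall : ∀ x : ℕ → ℚ, (∀ j, L (x j)) → (∑ i ∈ range (j0 + 2), zl G x i) % 2 ≠ 0 →
      2 ^ (φ.manBits + 1) < (∑ i ∈ range (j0 + 2), zl G x i).natAbs →
      ((Bn : ℚ) + 1) / 2 ^ G ≤ ∑ i ∈ range (j0 + 2), |x i|)
    (hQ : M * (j0 + 2) + Q = 2 * 2 ^ (φ.manBits + 1))
    (H1 : 2 * 2 ^ (φ.manBits + 1) * (M + 1) + Q * (M + 2 * d)
      ≤ Q * 2 ^ (φ.manBits + 1) + M * (M + 1)) :
    W (j0 + 1 + d) ≤ max (((d + 1 : ℕ) : ℚ) / ((Bn : ℚ) + ((d + 1 : ℕ) : ℚ)))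
      ((d : ℚ) / (2 ^ (φ.manBits + 1) + d)) := by
  obtain ⟨x, hx, hW⟩ := hWge (j0 + 1 + d)
  rw [hW]
  exact relErr_le_firstRegimeLaw (fun j => hL _ (hx j)) hq hR hm0M hMT hm0 hME hj0 (hBall x hx)
    hQ H1

end Rows

/-! ### E2M1²: grid `2^-2`, `M = 144`, `m₀ = 9`; every precision `p ≥ 13`, `p ≡ 1, 2 (mod 6)` -/

/-- Every letter of `Π(E2M1,E2M1)` is a grid letter of `(2, 144, 9)`. [cell] -/
theorem piE2M1_grid : ∀ q, q ∈ piE2M1 →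
    ∃ z : ℤ, q = (z : ℚ) / 2 ^ 2 ∧ z.natAbs ≤ 144 ∧ (z % 2 = 0 ∨ z.natAbs ≤ 9) :=
  fun q h => ⟨(4 * q).num, by rw [show ((2 : ℚ) ^ 2) = 4 by norm_num]; exact eq_num_div h,
    (letter_facts q h).2.1, (letter_facts q h).2.2⟩

/-- `W_φ` of E2M1² is the attained maximum over words of the alphabet. [cell] -/
theorem worstP_specE (φ : Format) :
    (∀ x : ℕ → ℚ, (∀ j, x j ∈ piE2M1) → ∀ m, relErr φ x m ≤ worstRelErrE2M1 φ m) ∧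
    (∀ m, ∃ x : ℕ → ℚ, (∀ j, x j ∈ piE2M1) ∧ worstRelErrE2M1 φ m = relErr φ x m) := by
  refine ⟨fun x hx m => relErr_le_worstP φ x hx m, fun m => ?_⟩
  obtain ⟨w, -, hw⟩ := exists_mem_eq_sup'
    (univ_nonempty : (univ : Finset (Fin (m + 1) → Fin 37)).Nonempty)
    (fun w => relErr φ (wordInput w) m)
  exact ⟨wordInput w, wordInput_mem w, hw⟩

/-- DEFICITS of `Π(E2M1,E2M1)` in quarter units (`|z| = 144 - e`): an even letter has `e = 0` or
`e ≥ 48`; an odd letter (`¼, ¾, 9/4`) has `e ∈ {143, 141, 135}`. [cell, kernel] -/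
theorem piE2M1_deficit : ∀ q ∈ piE2M1,
    ((4 * q).num % 2 = 0 ∧ (144 - (4 * q).num.natAbs = 0 ∨ 48 ≤ 144 - (4 * q).num.natAbs)) ∨
    ((4 * q).num % 2 ≠ 0 ∧ (144 - (4 * q).num.natAbs = 135 ∨ 144 - (4 * q).num.natAbs = 141 ∨
      144 - (4 * q).num.natAbs = 143)) := by
  decide +kernel

/-- `H_B` FOR E2M1², every precision: an odd partial sum of `j₀ + 2` letters beyond `T` in modulus
(`144(j₀+2) = B + 144`, `B ≤ T + 38`) has mass `≥ B + 1` — with an odd letter the total deficit is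
`135, 141, 143` or `≥ 183`. [cell, gemm.tex Prop. p:fpP (v)] -/
theorem e2m1_entryMass {x : ℕ → ℚ} (hx : ∀ j, x j ∈ piE2M1) {j0 T Bn : ℕ}
    (hn : 144 * (j0 + 2) = Bn + 144) (hBn : Bn ≤ T + 38) :
    (∑ i ∈ range (j0 + 2), zl 2 x i) % 2 ≠ 0 → T < (∑ i ∈ range (j0 + 2), zl 2 x i).natAbs →
      ((Bn : ℚ) + 1) / 2 ^ 2 ≤ ∑ i ∈ range (j0 + 2), |x i| := by
  have hz : ∀ i, zl 2 x i = (4 * x i).num := fun i => by unfold zl; norm_num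
  exact entryMass_of_automaton (fun j => piE2M1_grid _ (hx j))
    (Pe := fun e => e = 0 ∨ 48 ≤ e) (Po := fun e => e = 135 ∨ e = 141 ∨ e = 143)
    (EOK := fun D => D = 0 ∨ 48 ≤ D) (OOK := fun D => D = 135 ∨ D = 141 ∨ D = 143 ∨ 183 ≤ D)
    (Or.inl rfl) (fun D e hD he => by omega) (fun D e hD he => by omega)
    (fun D e hD he => by omega) (fun i => by rw [hz]; exact piE2M1_deficit _ (hx i))
    (fun D L hO hL hT => by omega)

section E2M1

variable {φ : Format} (hm : 12 ≤ φ.manBits) (hq : φ.qexp ≤ -2)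
  (hR : (2 : ℚ) ^ (φ.manBits + 10) ≤ φ.maxRat)
include hm hq hR

/-- UPPER HALF for E2M1², every precision `p ≥ 13`: with `144 j₀ + 9 < T`, `144(j₀+2) = B + 144`,
`B ≤ T + 38` and `k = d+1 ≤ 2^(p-1) - 2^8`: `W_φ(j₀+1+d) ≤ max((d+1)/(B+d+1), d/(T+d))`.
[cell, gemm.tex Prop. p:fpP (v)] -/
theorem worstP_le_firstRegimeLaw {j0 Bn d : ℕ} (hj0 : 144 * j0 + 9 < 2 ^ (φ.manBits + 1))
    (hn : 144 * (j0 + 2) = Bn + 144) (hBn : Bn ≤ 2 ^ (φ.manBits + 1) + 38)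
    (hd : d + 1 + 256 ≤ 2 ^ φ.manBits) :
    worstRelErrE2M1 φ (j0 + 1 + d) ≤ max (((d + 1 : ℕ) : ℚ) / ((Bn : ℚ) + ((d + 1 : ℕ) : ℚ)))
      ((d : ℚ) / (2 ^ (φ.manBits + 1) + d)) := by
  have hT2 : 2 ^ (φ.manBits + 1) = 2 * 2 ^ φ.manBits := by ring
  have hT13 : 8192 ≤ 2 ^ (φ.manBits + 1) :=
    le_trans (by norm_num) (Nat.pow_le_pow_right (by norm_num) (by omega : 13 ≤ φ.manBits + 1))
  obtain ⟨Q, hQ⟩ : ∃ Q, 144 * (j0 + 2) + Q = 2 * 2 ^ (φ.manBits + 1) :=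
    ⟨2 * 2 ^ (φ.manBits + 1) - 144 * (j0 + 2), by omega⟩
  have H1 : 2 * 2 ^ (φ.manBits + 1) * (144 + 1) + Q * (144 + 2 * d)
      ≤ Q * 2 ^ (φ.manBits + 1) + 144 * (144 + 1) := by
    have hprod : Q * (2 * d + 514) ≤ Q * 2 ^ (φ.manBits + 1) := Nat.mul_le_mul_left _ (by omega)
    have h2 : Q * (144 + 2 * d) + 370 * Q ≤ Q * 2 ^ (φ.manBits + 1) := by
      rw [show Q * (144 + 2 * d) + 370 * Q = Q * (2 * d + 514) by ring]; exact hprod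
    have h3 : 290 * 2 ^ (φ.manBits + 1) ≤ 370 * Q + 20880 := by omega
    generalize 2 ^ (φ.manBits + 1) = t at h2 h3 ⊢
    linarith
  exact gridW_le_firstRegimeLaw (L := fun q => q ∈ piE2M1) piE2M1_grid (worstP_specE φ).2 hq
    (E := 7) hR (by norm_num) (le_trans (by norm_num) hT13) (by norm_num) (by norm_num) hj0
    (fun x hx => e2m1_entryMass hx hn hBn) hQ H1

/-- THE EXACT FIRST-REGIME LAW OF E2M1² for `p ≡ 1 (mod 6)`, `p ≥ 13` (`144 j₀ + 128 = T`,
`n₀ = j₀ + 1`, e.g. `p = 13, 19, 25, …`): `W_φ(n₀ + k) = max(k/(T+16+k), (k-1)/(T+k-1))` for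
`1 ≤ k ≤ 2^(p-1) - 2^8` (index `m = j₀ + 1 + d`, `k = d + 1`); BOTH families `36^{×n₀} ¼^{×k}`
and `16, 16, 36^{×j₀}, ¼^{×(k-1)}` are needed (they cross at `k ≈ 2^(p/2-2)`).
[cell, gemm.tex Prop. p:fpP (v)] -/
theorem worstP_firstRegimeLaw_one {j0 : ℕ} (hj0 : 144 * j0 + 128 = 2 ^ (φ.manBits + 1)) {d : ℕ}
    (hd : d + 1 + 256 ≤ 2 ^ φ.manBits) :
    worstRelErrE2M1 φ (j0 + 1 + d)
      = max (((d + 1 : ℕ) : ℚ) / (2 ^ (φ.manBits + 1) + 16 + ((d + 1 : ℕ) : ℚ)))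
        ((d : ℚ) / (2 ^ (φ.manBits + 1) + d)) := by
  have h7 : 7 ≤ φ.manBits := by omega
  have hup := worstP_le_firstRegimeLaw hm hq hR (j0 := j0) (Bn := 2 ^ (φ.manBits + 1) + 16)
    (d := d) (by omega) (by omega) (by omega) hd
  have hpl := le_worstP_plateau h7 hq hR (j0 := j0) (by omega) (by omega) (d + 1)
  have hle := le_worstP_lateEntry h7 hq hR (j0 := j0) (C := 64) (D := 64) (by norm_num [piE2M1])
    (by norm_num [piE2M1]) (by omega) (by omega) d
  have e144 : (144 : ℚ) * (j0 + 1) = 2 ^ (φ.manBits + 1) + 16 := by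
    exact_mod_cast (show 144 * (j0 + 1) = 2 ^ (φ.manBits + 1) + 16 by omega)
  rw [show j0 + (d + 1) = j0 + 1 + d by ring, e144] at hpl
  push_cast at hup hpl hle ⊢
  exact le_antisymm hup (max_le hpl hle)

/-- THE EXACT FIRST-REGIME LAW OF E2M1² for `p ≡ 2 (mod 6)`, `p ≥ 14` (`144 j₀ + 112 = T`,
`n₀ = j₀ + 1`, e.g. `p = 14, 20, 26, …`): `W_φ(n₀ + k) = max(k/(T+32+k), (k-1)/(T+k-1))` for
`1 ≤ k ≤ 2^(p-1) - 2^8`; the families are `36^{×n₀} ¼^{×k}` and `16, 12, 36^{×j₀}, ¼^{×(k-1)}`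
(the bfloat16 law `p = 8`, gemm.tex Prop. p:bf16law, has the same shape but `n₀ = 2`).
[cell, gemm.tex Prop. p:fpP (v)] -/
theorem worstP_firstRegimeLaw_two {j0 : ℕ} (hj0 : 144 * j0 + 112 = 2 ^ (φ.manBits + 1)) {d : ℕ}
    (hd : d + 1 + 256 ≤ 2 ^ φ.manBits) :
    worstRelErrE2M1 φ (j0 + 1 + d)
      = max (((d + 1 : ℕ) : ℚ) / (2 ^ (φ.manBits + 1) + 32 + ((d + 1 : ℕ) : ℚ)))
        ((d : ℚ) / (2 ^ (φ.manBits + 1) + d)) := by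
  have h7 : 7 ≤ φ.manBits := by omega
  have hup := worstP_le_firstRegimeLaw hm hq hR (j0 := j0) (Bn := 2 ^ (φ.manBits + 1) + 32)
    (d := d) (by omega) (by omega) (by omega) hd
  have hpl := le_worstP_plateau h7 hq hR (j0 := j0) (by omega) (by omega) (d + 1)
  have hle := le_worstP_lateEntry h7 hq hR (j0 := j0) (C := 64) (D := 48) (by norm_num [piE2M1])
    (by norm_num [piE2M1]) (by omega) (by omega) d
  have e144 : (144 : ℚ) * (j0 + 1) = 2 ^ (φ.manBits + 1) + 32 := by
    exact_mod_cast (show 144 * (j0 + 1) = 2 ^ (φ.manBits + 1) + 32 by omega)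
  rw [show j0 + (d + 1) = j0 + 1 + d by ring, e144] at hpl
  push_cast at hup hpl hle ⊢
  exact le_antisymm hup (max_le hpl hle)

end E2M1

/-! ### E2M3·E2M1 into binary32: `B = 2^24 + 4` (`A* = 2^24 + 5`) -/

/-- DEFICITS of `Λ(E2M3·E2M1)` (`|z| = 720 - e`): an even letter has `48 ∣ e ≤ 240` or `e ≥ 272`;
an odd letter has `e ≥ 675`, `e` odd, and `e ≡ 3 (mod 6)` or `e mod 48 ≥ 35`. [cell, kernel] -/
theorem lamMixA_deficit : ∀ z ∈ e2m3e2m1Law.lam,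
    (z % 2 = 0 ∧ ((720 - z.natAbs) % 48 = 0 ∧ 720 - z.natAbs ≤ 240 ∨ 272 ≤ 720 - z.natAbs)) ∨
    (z % 2 ≠ 0 ∧ (675 ≤ 720 - z.natAbs ∧ (720 - z.natAbs) % 2 = 1 ∧
      ((720 - z.natAbs) % 6 = 3 ∨ 35 ≤ (720 - z.natAbs) % 48))) := by
  decide +kernel

/-- The grid numerators of a word over `Λ(E2M3·E2M1)/2^4` are letters of `Λ`. [cell] -/
theorem zl_memA {x : ℕ → ℚ} (hx : ∀ j, e2m3e2m1Law.PiL 4 (x j)) (i : ℕ) :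
    zl 4 x i ∈ e2m3e2m1Law.lam := by
  obtain ⟨z, hz, hq⟩ := hx i
  unfold zl; rw [hq, num_two_pow_mul_div]; exact hz

/-- `H_B` FOR E2M3·E2M1 INTO binary32: an odd partial sum of `23303` letters beyond `2^24` in
modulus has mass `≥ 2^24 + 5` (grid units) — with an odd letter the total deficit `D` of
`720·23303 = 2^24 + 944` is `≥ 947` or odd with `D ≡ 3 (mod 6)` or `D mod 48 ≥ 35`, which excludes
`D = 941, 943`. [cell, gemm.tex Prop. p:fpA (v); C2 `entry_p24.json`] -/
theorem mixA_entryMass_Binary32 {x : ℕ → ℚ} (hx : ∀ j, e2m3e2m1Law.PiL 4 (x j)) :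
    (∑ i ∈ range (23301 + 2), zl 4 x i) % 2 ≠ 0 →
      16777216 < (∑ i ∈ range (23301 + 2), zl 4 x i).natAbs →
      (((16777220 : ℕ) : ℚ) + 1) / 2 ^ 4 ≤ ∑ i ∈ range (23301 + 2), |x i| :=
  entryMass_of_automaton (fun j => piMixA_grid _ (hx j))
    (Pe := fun e => e % 48 = 0 ∧ e ≤ 240 ∨ 272 ≤ e)
    (Po := fun e => 675 ≤ e ∧ e % 2 = 1 ∧ (e % 6 = 3 ∨ 35 ≤ e % 48))
    (EOK := fun D => D % 48 = 0 ∧ D ≤ 240 ∨ 272 ≤ D)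
    (OOK := fun D => 947 ≤ D ∨ (675 ≤ D ∧ D % 2 = 1 ∧ (D % 6 = 3 ∨ 35 ≤ D % 48)))
    (Or.inl ⟨rfl, by norm_num⟩) (fun D e hD he => by omega) (fun D e hD he => by omega)
    (fun D e hD he => by omega) (fun i => lamMixA_deficit _ (zl_memA hx i))
    (fun D L hO hL hT => by omega)

/-- THE EXACT FIRST-REGIME LAW OF E2M3·E2M1 INTO binary32 (`p = 24`, sequential RNE accumulation of
exact products): `W_24(n₀ + k) = max(k/(2^24+4+k), (k-1)/(2^24+k-1))` for `1 ≤ k ≤ 2^23 - 2^11`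
(`n₀ = 23302`; index `m = 23302 + d`, `k = d + 1`): the deficient entry family
`480, 720^{×23301}, 21, 1^{×(k-1)}` and the late family `480, 720^{×23301}, 16, 1^{×(k-1)}` are
jointly optimal. [cell, gemm.tex Prop. p:fpA (v); cite: LangeRump2019; BoldoEtAl2023, Thm 4.5] -/
theorem worst4P_Binary32_law {d : ℕ} (hd : d + 1 + 2 ^ 11 ≤ 2 ^ 23) :
    worstRelErrMixA Format.Binary32 (23302 + d)
      = max (((d + 1 : ℕ) : ℚ) / (2 ^ 24 + 4 + ((d + 1 : ℕ) : ℚ))) ((d : ℚ) / (2 ^ 24 + d)) := by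
  obtain ⟨h1, h2, h3, h4⟩ := Binary32_hyps4
  have hT : 2 ^ (Format.Binary32.manBits + 1) = 16777216 := by rw [pow_succ, h4]; norm_num
  have hup := gridW_le_firstRegimeLaw piMixA_grid (worst4P_spec Format.Binary32).2 h2 (E := 9) h3
    (by norm_num) (mixA_MT h1) (by norm_num) (by norm_num) (j0 := 23301) (Bn := 16777220)
    (Q := 16776272) (d := d) (by omega)
    (by rw [hT]; exact fun x hx => mixA_entryMass_Binary32 hx) (by omega) (by omega)
  rw [show (23301 : ℕ) + 1 + d = 23302 + d by ring,
    show Format.Binary32.manBits + 1 = 24 from rfl] at hup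
  refine le_antisymm (le_trans hup (le_of_eq ?_))
    (max_le (worst4P_Binary32_entry d) (worst4P_Binary32_late d))
  norm_num

/-! ### E3M2·E2M1 into binary32: `B = 2^24 + 512` (`A* = 2^24 + 513`) -/

/-- DEFICITS of `Λ(E3M2·E2M1)` (`|z| = 5376 - e`): an even letter has `e ∈ {0, 768}` or
`e ≥ 1536`; an odd letter has `5355 ≤ e ≤ 5375`. [cell, kernel] -/
theorem lamMixB_deficit : ∀ z ∈ e3m2e2m1Law.lam,
    (z % 2 = 0 ∧ (5376 - z.natAbs = 0 ∨ 5376 - z.natAbs = 768 ∨ 1536 ≤ 5376 - z.natAbs)) ∨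
    (z % 2 ≠ 0 ∧ (5355 ≤ 5376 - z.natAbs ∧ 5376 - z.natAbs ≤ 5375)) := by
  decide +kernel

/-- The grid numerators of a word over `Λ(E3M2·E2M1)/2^5` are letters of `Λ`. [cell] -/
theorem zl_memB {x : ℕ → ℚ} (hx : ∀ j, e3m2e2m1Law.PiL 5 (x j)) (i : ℕ) :
    zl 5 x i ∈ e3m2e2m1Law.lam := by
  obtain ⟨z, hz, hq⟩ := hx i
  unfold zl; rw [hq, num_two_pow_mul_div]; exact hz

/-- `H_B` FOR E3M2·E2M1 INTO binary32: an odd partial sum of `3122` letters beyond `2^24` in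
modulus has mass `≥ 2^24 + 513` — with an odd letter the total deficit of `5376·3122 = 2^24 + 6656`
lies in `[5355, 5375] ∪ [6123, 6143]` or is `≥ 6891`. [cell, gemm.tex Prop. p:fpA (v); C2] -/
theorem mixB_entryMass_Binary32 {x : ℕ → ℚ} (hx : ∀ j, e3m2e2m1Law.PiL 5 (x j)) :
    (∑ i ∈ range (3120 + 2), zl 5 x i) % 2 ≠ 0 →
      16777216 < (∑ i ∈ range (3120 + 2), zl 5 x i).natAbs →
      (((16777728 : ℕ) : ℚ) + 1) / 2 ^ 5 ≤ ∑ i ∈ range (3120 + 2), |x i| :=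
  entryMass_of_automaton (fun j => piMixB_grid _ (hx j))
    (Pe := fun e => e = 0 ∨ e = 768 ∨ 1536 ≤ e) (Po := fun e => 5355 ≤ e ∧ e ≤ 5375)
    (EOK := fun D => D = 0 ∨ D = 768 ∨ 1536 ≤ D)
    (OOK := fun D => (5355 ≤ D ∧ D ≤ 5375) ∨ (6123 ≤ D ∧ D ≤ 6143) ∨ 6891 ≤ D)
    (Or.inl rfl) (fun D e hD he => by omega) (fun D e hD he => by omega)
    (fun D e hD he => by omega) (fun i => lamMixB_deficit _ (zl_memB hx i))
    (fun D L hO hL hT => by omega)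

/-- THE EXACT FIRST-REGIME LAW OF E3M2·E2M1 INTO binary32 (`p = 24`):
`W_24(n₀ + k) = max(k/(2^24+512+k), (k-1)/(2^24+k-1))` for `1 ≤ k ≤ 2^23 - 2^13` (`n₀ = 3121`;
index `m = 3121 + d`, `k = d + 1`): the families `4608, 5376^{×3120}, 1, 1^{×(k-1)}` (entry at
`2^24 + 513`) and `2048, 5376, 5376^{×3119}, 2048, 1^{×(k-1)}` (late entry) are jointly optimal.
[cell, gemm.tex Prop. p:fpA (v); cite: LangeRump2019; BoldoEtAl2023, Thm 4.5] -/
theorem worst5P_Binary32_law {d : ℕ} (hd : d + 1 + 2 ^ 13 ≤ 2 ^ 23) :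
    worstRelErrMixB Format.Binary32 (3121 + d)
      = max (((d + 1 : ℕ) : ℚ) / (2 ^ 24 + 512 + ((d + 1 : ℕ) : ℚ))) ((d : ℚ) / (2 ^ 24 + d)) := by
  obtain ⟨h1, h2, h3, h4⟩ := Binary32_hyps5
  have hT : 2 ^ (Format.Binary32.manBits + 1) = 16777216 := by rw [pow_succ, h4]; norm_num
  have hup := gridW_le_firstRegimeLaw piMixB_grid (worst5P_spec Format.Binary32).2 h2 (E := 12) h3
    (by norm_num) (mixB_MT h1) (by norm_num) (by norm_num) (j0 := 3120) (Bn := 16777728)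
    (Q := 16770560) (d := d) (by omega)
    (by rw [hT]; exact fun x hx => mixB_entryMass_Binary32 hx) (by omega) (by omega)
  rw [show (3120 : ℕ) + 1 + d = 3121 + d by ring,
    show Format.Binary32.manBits + 1 = 24 from rfl] at hup
  refine le_antisymm (le_trans hup (le_of_eq ?_))
    (max_le (worst5P_Binary32_entry d) (worst5P_Binary32_late d))
  norm_num

end Summit.Ventures.CertifiedArithmetic.LowPrec.Gemm
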